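import Mathlib
import Literature.NumberTheory.Sieve.LevelOfDistribution

/-!
# Sketch — crux EH (stmt-Parity-11314), crux-ideate round 1, ideator 2

First lemmas of the two idea cards, stated over existing declarations
(`Literature.NumberTheory.Sieve.primeAPError`, `.LevelOfDistribution.chebyshevPsiMod`,
`.PrimesHaveLevel`, `.BombieriVinogradovStatement`, `.LevelOfDistribution.ElliottHalberstam`,
Mathlib's `DirichletCharacter`, `ArithmeticFunction.vonMangoldt`). Nothing here is proved; the
point is that the statements elaborate.
-/

open Finset Real Filter Asymptotics
open Literature.NumberTheory.Sieve

namespace Summit.Parity.GeneralizedHardyLittlewood.Cruxes.EH.SketchIdeator2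

/- The crux decl `Summit.Parity.GeneralizedHardyLittlewood.Theses.LiouvilleShiftedTables.EH` is
`Iff.rfl`-equal to `LevelOfDistribution.ElliottHalberstam` (certified in the folder copy Sketch.lean,
which imports the route file; `lean check` rc 0 at 2026-08-16T04:00Z). This tree copy drops the route
import so that it elaborates while the farm's copy of the route module is being re-synced. -/

/-! ## Card `upward-replication-free-factorability` -/

/-- **Replication lemma (first lemma of the card).** For `x ≥ 1`, `q ≥ 1` and a prime `p ∤ q`,
the maximal discrepancy `E*(x; q) = max_{y ≤ x} max_{(a,q)=1} |ψ(y;q,a) − y/φ(q)|` is at most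
`(p − 1) E*(x; qp) + log x`: the classes `a' (mod qp)` over a class `a (mod q)` partition it (up to the
`≤ log x / log p` prime powers of `p` in it, total `Λ`-mass `≤ log x`) and `(p−1)/φ(qp) = 1/φ(q)`,
so by pigeonhole one child class carries at least the average bias. -/
def ReplicationLemma : Prop :=
  ∀ x : ℝ, 1 ≤ x → ∀ q : ℕ, 1 ≤ q → ∀ p : ℕ, p.Prime → ¬ p ∣ q →
    primeAPError x q ≤ ((p : ℝ) - 1) * primeAPError x (q * p) + Real.log x

/-- Fibre identity behind the replication lemma, at one height `y` and one class `a`: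
`∑_{a' unit mod qp, a' ≡ a (mod q)} ψ(y; qp, a') = ψ(y; q, a) − ∑_{n ≤ y, n ≡ a (q), p ∣ n} Λ(n)`. -/
def FibreIdentity : Prop :=
  ∀ y : ℝ, ∀ q : ℕ, 1 ≤ q → ∀ p : ℕ, p.Prime → ¬ p ∣ q → ∀ a : ℕ, a.Coprime q →
    (∑ b ∈ (range (q * p)).filter (fun b => b.Coprime (q * p) ∧ b ≡ a [MOD q]),
        LevelOfDistribution.chebyshevPsiMod (q * p) (b : ZMod (q * p)) y) =
      LevelOfDistribution.chebyshevPsiMod q (a : ZMod q) y -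
        ∑ n ∈ (range (⌊y⌋₊ + 1)).filter (fun n => p ∣ n),
          ArithmeticFunction.vonMangoldt.residueClass (a : ZMod q) n

/-- **Transfer target `FEH` (factor-augmented Elliott–Halberstam).** For every `θ < 1` there is
`η > 0` such that, on average over the auxiliary primes `p ∈ (x^η, 2x^η]`, the moduli `q·p` with
`q ≤ x^{θ−ε}` ARBITRARY satisfy the Bombieri–Vinogradov bound with the maximum over residues:
`∑_{q ≤ x^{θ−ε}} ∑_{p ∼ x^η prime} E*(x; qp) ≪ x (log x)^{−A}` (the normalisation of EH at level `θ + η`: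
each modulus `qp` is counted at most `⌈1/η⌉` times and its classes hold `x/φ(qp)` expected mass).
Every modulus counted has a prime factor of the prescribed size `x^η` (and is averaged over it). -/
def FactorAugmentedEH : Prop :=
  ∀ θ : ℝ, θ < 1 → ∃ η : ℝ, 0 < η ∧ θ + η < 1 ∧ ∀ A : ℝ, 0 < A → ∀ ε : ℝ, 0 < ε →
    (fun x : ℝ => ∑ q ∈ Icc 1 ⌊x ^ (θ - ε)⌋₊,
        ∑ p ∈ (Ioc ⌊x ^ η⌋₊ ⌊2 * x ^ η⌋₊).filter Nat.Prime, primeAPError x (q * p)) =O[atTop]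
      fun x : ℝ => x / Real.log x ^ A

/-- `FEH` is implied by the crux (a sub-sum of the EH sum at level `θ + η`, each modulus `qp` counted
at most `⌈1/η⌉` times). -/
def FEH_of_EH : Prop := LevelOfDistribution.ElliottHalberstam → FactorAugmentedEH

/-- **The transfer**: replication + `FEH` give the crux. Averaging the replication lemma over the
`≫ x^η / log x` primes `p ∼ x^η` (Chebyshev lower bound) turns `∑_q E*(x;q)` into
`≤ (#{p ∼ x^η})⁻¹ ∑_q ∑_{p ∤ q} ((p − 1) E*(x;qp) + log x) ≤ 8η log x · ∑_q ∑_p E*(x;qp) + x^{θ} log x`. -/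
def EH_of_FEH : Prop := ReplicationLemma → FactorAugmentedEH → LevelOfDistribution.ElliottHalberstam

/-- Density form at the top level (second payoff of the same lever): for every `ε, B` there is `B'`
such that all but `x^{1−ε}(log x)^{−B'}` moduli `q ∼ x^{1−ε}` have NO reduced class whose prime
count deviates relatively by `(log x)^{−B}`. -/
def TopLevelPurity : Prop :=
  ∀ ε : ℝ, 0 < ε → ε < 1 / 2 → ∀ B : ℝ, 0 < B → ∀ B' : ℝ, 0 < B' → ∃ x₀ : ℝ, ∀ x : ℝ, x₀ ≤ x →
    (((Ioc ⌊x ^ (1 - ε)⌋₊ ⌊2 * x ^ (1 - ε)⌋₊).filter (fun q : ℕ =>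
        x / ((Nat.totient q : ℝ) * Real.log x ^ B) ≤ primeAPError x q)).card : ℝ) ≤
      x ^ (1 - ε) / Real.log x ^ B'

/-- Equivalence of the crux with its top-level density form (replication upward to level
`x^{1−ε}` + Brun–Titchmarsh in one direction, Markov in the other). -/
def EH_iff_TopLevelPurity : Prop :=
  ReplicationLemma → (LevelOfDistribution.ElliottHalberstam ↔ TopLevelPurity)

/-! ## Card `moment-ladder-pattern-complexity` -/

/-- `ψ(x, χ) = ∑_{n ≤ x} Λ(n) χ(n)`. -/
noncomputable def psiChi (x : ℝ) {q : ℕ} (χ : DirichletCharacter ℂ q) : ℂ :=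
  ∑ n ∈ range (⌊x⌋₊ + 1), (ArithmeticFunction.vonMangoldt n : ℂ) * χ (n : ZMod q)

/-- High-conductor part of the discrepancy: `Δ♯_D(x; q, a) = φ(q)⁻¹ ∑_{χ mod q, cond χ > D} χ̄(a) ψ(x, χ)`
(the characters of conductor `≤ D = x^{1/2−ε}` are exactly the Bombieri–Vinogradov-handled part,
with the maximum over `a`, at ANY level; only conductors `> x^{1/2}` obstruct). -/
noncomputable def highCondDiscrepancy (D x : ℝ) (q : ℕ) (a : ℕ) : ℂ :=
  haveI : Fintype (DirichletCharacter ℂ q) := Fintype.ofFinite _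
  (Nat.totient q : ℂ)⁻¹ *
    ∑ χ : DirichletCharacter ℂ q,
      if D < (χ.conductor : ℝ) then (starRingEnd ℂ) (χ (a : ZMod q)) * psiChi x χ else 0

/-- **Rung `k` of the ladder (`MomentRung k`)**: for `Q ∈ [x^{1/2}, x^{k/(k+1) − ε}]`, outside an
exceptional set of `≤ Q x^{−η}` moduli (room for the `O(1)` possible Linnik–Siegel-exceptional conductors,
which a `2k`-th power would otherwise amplify; they cost EH only `x^{1−η} log x` by Brun–Titchmarsh), the
`2k`-th moment over all reduced classes and all moduli `q ∼ Q` of `Δ♯` obeys the bound the Hölder step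
consumes, `∑_{q ∼ Q, q ∉ 𝓔} ∑_a |Δ♯|^{2k} ≤ x^{2k−η} Q^{1−2k}`; the range `Q ≤ x^{k/(k+1)−ε}` is exactly where
this is consistent with the flat (random-model) size `Q^{2−k} x^k (log x)^k`. `k = 1` is Barban–Davenport–
Halberstam (`Q x log x ≤ x^{2−η}/Q` iff `Q ≤ x^{(1−η)/2}`); `k = 2` at `Q = x^{2/3−ε}` is the first open rung. -/
def MomentRung (k : ℕ) : Prop :=
  ∀ ε : ℝ, 0 < ε → ∃ η : ℝ, 0 < η ∧ ∃ x₀ : ℝ, ∀ x : ℝ, x₀ ≤ x → ∀ Q : ℝ, x ^ (1 / 2 : ℝ) ≤ Q →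
    Q ≤ x ^ ((k : ℝ) / (k + 1) - ε) →
      ∃ E : Finset ℕ, E ⊆ Ioc ⌊Q⌋₊ ⌊2 * Q⌋₊ ∧ (E.card : ℝ) ≤ Q * x ^ (-η) ∧
        ∑ q ∈ Ioc ⌊Q⌋₊ ⌊2 * Q⌋₊ \ E, ∑ a ∈ (range q).filter (fun a => a.Coprime q),
            ‖highCondDiscrepancy (x ^ (1 / 2 - ε)) x q a‖ ^ (2 * k) ≤
          x ^ ((2 : ℝ) * k - η) / Q ^ ((2 : ℝ) * k - 1)

/-- **Hölder dequantisation (first lemma of the card)**: Bombieri–Vinogradov (conductors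
`≤ x^{1/2−ε}`, with the max over residues, any level) plus every rung of the ladder give the crux:
`∑_{q∼Q, q∉𝓔} max_a |Δ♯| ≤ Q^{1−1/(2k)} (∑ ∑ |Δ♯|^{2k})^{1/(2k)} ≤ x^{1−η/(2k)}` for
`Q ≤ x^{k/(k+1)−ε}`, and `k/(k+1) → 1`. -/
def EH_of_MomentRungs : Prop :=
  BombieriVinogradovStatement → (∀ k : ℕ, 1 ≤ k → MomentRung k) → LevelOfDistribution.ElliottHalberstam

/-- The pure inequality behind the dequantisation, for any finite family of nonnegative reals
indexed by moduli and classes (Hölder / power mean). -/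
theorem hoelder_sup_le {ι : Type*} (S : Finset ι) (κ : ι → Type*) [∀ i, Fintype (κ i)]
    [∀ i, Nonempty (κ i)] (f : ∀ i, κ i → ℝ) (hf : ∀ i a, 0 ≤ f i a) (k : ℕ) (hk : 1 ≤ k) :
    (∑ i ∈ S, ⨆ a, f i a) ^ (2 * k) ≤
      (S.card : ℝ) ^ (2 * k - 1) * ∑ i ∈ S, ∑ a, f i a ^ (2 * k) := by
  sorry

end Summit.Parity.GeneralizedHardyLittlewood.Cruxes.EH.SketchIdeator2
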